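import Literature.NumberTheory.EllipticCurves.IwasawaAlgebraEisensteinUnitCoeffNotDvdProofs
import Literature.NumberTheory.EllipticCurves.IwasawaAlgebraSpecializationCountProofs
import Literature.NumberTheory.EllipticCurves.IwasawaAlgebraEisensteinQuotientDVRProofs
import Literature.NumberTheory.EllipticCurves.IwasawaAlgebraEisensteinSpecializationUnitProofs
import Mathlib.RingTheory.PowerSeries.WeierstrassPreparation
import HarnessLib

/-!
# The index of `(F, q_m)` in `Λ` is `p^{s}`, `s` the Weierstrass degree of `F`, for EVERY `m > s`:
# `m`-uniform cardinality bounds for Howard's Eisenstein quotients `S_m/(F̄)` (proofs file)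

`Proofs` file (theorems only; no definition, no named fact, no instance, no `sorry`) in topic
`NumberTheory/EllipticCurves`, in the vocabulary of the tree's Iwasawa algebra `Λ = ℤ_p⟦T⟧`
(`IwasawaAlgebra p = PowerSeries ℤ_[p]`) and Howard's discrete valuation rings `S_m = Λ/(q_m)`,
`q_m = T^m + p` (always written `IwasawaAlgebra p ⧸ Ideal.span {X ^ m + C p}`), companion of
`IwasawaAlgebraEisensteinUnitCoeffNotDvdProofs` (finiteness of `S_m/(F̄)` for `F` with a unit coefficient
below degree `m`) and `IwasawaAlgebraSpecializationCountProofs` (`#(Λ/(f, q_m)) = p^{deg f}` for a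
DISTINGUISHED `f` of degree `< m`).

WHAT. Let `F ∈ Λ` have non-zero reduction modulo `p` and let `s := ord_T (F mod p)` be its WEIERSTRASS
DEGREE (`(F.map (IsLocalRing.residue ℤ_[p])).order.toNat`; `s ≤ k` as soon as `coeff_k F` is a unit,
§1). Then, by Mathlib's Weierstrass preparation theorem `F = f · u` (`f` distinguished of degree `s`, `u` a
unit; `PowerSeries.exists_isWeierstrassFactorization`), `(F, q_m) = (f, q_m)` and the tree's count for
distinguished polynomials gives
* §2 **`natCard_quotient_span_sup_span_qm_eq_pow_order`: `#(Λ/(F, q_m)) = p^s` for every `m > s`** —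
  INDEPENDENT of `m`; hence **`natCard_quotient_span_sup_span_qm_le_of_isUnit_coeff`:
  `#(Λ/(F, q_m)) ≤ p^k`** whenever `coeff_k F` is a unit and `k < m` (and the quotient is finite);
* §3 the same in `S_m`-currency (`DoubleQuot.quotQuotEquivQuotSup`): **`natCard_quotient_span_mk_eq_pow_order`
  (`#(S_m/(F̄)) = p^s`), `natCard_quotient_span_mk_le_of_isUnit_coeff` (`#(S_m/(F̄)) ≤ p^k`)** — the
  `m`-UNIFORM twin of the companion's `finite_quotient_span_mk_of_isUnit_coeff` — and the length form
  **`length_quotient_span_mk_eq_order`: `length_{S_m} (S_m/(F̄)) = s`**, i.e. `v_π(F̄) = s` for the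
  uniformiser `π = T̄` of `S_m` (`#N = p^{length N}`, tree `natCard_eq_pow_length_quotient_X_pow_add_C`);
* §4 the two letters the cell's consumers use: **`natCard_quotient_span_charTwistElement_le`:
  `#(S_m/(Δ̄)) ≤ p^{2N}`** for Howard's homogenised characteristic polynomial
  `Δ = C ℓ² + C (a₁ℓ)(1+T)^N + C a₀ (1+T)^{2N}` with `a₀` a unit and `m > 2N` (uniform in `ℓ` AND in `m`:
  the `m`-uniform form of the companion's `finite_quotient_span_charTwistElement`), and
  **`natCard_quotient_span_mk_onePlusX_pow_sub_one_le`: `#(S_m/((1+T)^n − 1)) ≤ p^n`** for `1 ≤ n < m`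
  (coefficient `n` of `(1+T)^n − 1` is `1`), with the exact value **`= p^{p^t}` for `n = p^t`**
  (`natCard_quotient_span_mk_onePlusX_prime_pow_sub_one_eq`, via the tree's `associated_onePlusX_pow_sub_one_X_pow`
  and `natCard_quotient_span_mk_X_pow_eq`: `#(S_m/(T̄^n)) = p^n` for `n < m`);
* §5 the STRUCTURE behind the count: **`associated_mk_mk_X_pow_order`: `F̄ ~ T̄^s` in `S_m`** (a
  distinguished `g` of degree `d < m` has `ḡ = T̄^d · unit`, `associated_mk_coe_mk_X_pow_natDegree`), hence
  **`X_pow_order_mem_span_sup_span_qm`: `T^s ∈ (F, q_m)`**, `X_pow_mem_span_sup_span_qm_of_isUnit_coeff`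
  (`T^k ∈ (F, q_m)` for a unit `coeff_k F`, `k < m`), and the letters `T^{2N} ∈ (Δ, q_m)`, `T^n ∈ ((1+T)^n − 1, q_m)`
  — `T`-power annihilators of the local error modules, uniform in `m`.

WHY (use; cell `pub/bsd-print-x9`, shared μ-crux `MuInequalityCoherentPair`, stub B / S1 = `m`-uniform
control along the Eisenstein primes `q_m = T^m + p`). Every local error term of the specialised control
maps at `q_m` is an index `#(S_m/(F̄))` for an `m`-independent `F ∈ Λ` with a unit coefficient in bounded
degree: the twisted fixed-point / `Hom(·, μ)` counts at finitely decomposed `v ∤ p` are bounded by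
`#(S_m/(Δ̄_ℓ))²` (`ZpExtensionEisensteinTwistFixedPointBoundProofs`), and at `v ∣ p` the graded piece is
`S_m/(ψ(g₀) − 1)` with `ψ(g₀) = (1+T)^{p^t}` for an inertia element `g₀` with `κ(g₀) = p^t`. The design
constraint of the `μ`-readout (errors must be CARDINALITY-bounded uniformly in `m`, since an error killed
by `p^c` has `S_m`-length `c·m` and survives division by `m`) is therefore met by §2–§4: all these indices
are `p^{Weierstrass degree}`, the same number for every `m` beyond that degree. [Howard 2004, proof of
Thm. 2.2.10: "taking `𝔮 = T^m + p` … bounded as `m` varies"]. Pure commutative algebra; nothing about Galois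
cohomology is asserted. BSD is not proved by any of this.

References: [Howard2004HeegnerKolyvagin] B. Howard, *The Heegner point Kolyvagin system*, Compositio Math.
140 (2004), §2.2 (`S_𝔮 = Λ/𝔮` a DVR), Lemma 2.2.7, Prop. 2.2.8 and proof of Thm. 2.2.10 (`𝔮 = T^m + p`);
[Washington1997] L. Washington, *Introduction to Cyclotomic Fields*, 2nd ed., GTM 83, §7.1 Thm. 7.3
(Weierstrass preparation), Prop. 7.2 (division), §13.2 Lemma 13.7 (`Λ/(f)` free of rank `deg f`).
-/

noncomputable section

open PowerSeries

universe v

namespace Literature.NumberTheory.EllipticCurves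

namespace IwasawaAlgebra

variable (p : ℕ) [hp : Fact p.Prime]

/-! ## §1 A unit coefficient in degree `k` bounds the Weierstrass degree by `k` -/

/-- If `coeff_k F` is a unit then `F mod p ≠ 0`. [cite: Washington1997, §7.1 (Thm. 7.3, hypothesis)] -/
theorem map_residue_ne_zero_of_isUnit_coeff {F : IwasawaAlgebra p} {k : ℕ} (hu : IsUnit (coeff k F)) :
    F.map (IsLocalRing.residue ℤ_[p]) ≠ 0 := by
  intro h
  have hk : coeff k (F.map (IsLocalRing.residue ℤ_[p])) = 0 := by rw [h, map_zero]
  rw [coeff_map] at hk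
  exact (hu.map (IsLocalRing.residue ℤ_[p])).ne_zero hk

/-- If `coeff_k F` is a unit then `ord_T (F mod p) ≤ k`. [cite: Washington1997, §7.1 (Thm. 7.3)] -/
theorem order_map_residue_le_of_isUnit_coeff {F : IwasawaAlgebra p} {k : ℕ} (hu : IsUnit (coeff k F)) :
    (F.map (IsLocalRing.residue ℤ_[p])).order ≤ k := by
  refine PowerSeries.order_le k ?_
  rw [coeff_map]
  exact (hu.map (IsLocalRing.residue ℤ_[p])).ne_zero

/-- If `coeff_k F` is a unit then the Weierstrass degree `(F mod p).order.toNat` is `≤ k`.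
[cite: Washington1997, §7.1 (Thm. 7.3)] -/
theorem toNat_order_map_residue_le_of_isUnit_coeff {F : IwasawaAlgebra p} {k : ℕ}
    (hu : IsUnit (coeff k F)) : (F.map (IsLocalRing.residue ℤ_[p])).order.toNat ≤ k := by
  have h := order_map_residue_le_of_isUnit_coeff p hu
  have hfin : (F.map (IsLocalRing.residue ℤ_[p])).order ≠ ⊤ :=
    ne_top_of_le_ne_top (ENat.coe_ne_top k) h
  rw [← ENat.coe_le_coe, ENat.coe_toNat hfin]
  exact h

/-! ## §2 `#(Λ/(F, q_m)) = p^{Weierstrass degree of F}` for every `m` beyond that degree -/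

/-- **Weierstrass preparation ⟹ `(F) = (f)` for the distinguished polynomial `f` of `F`.**
[cite: Washington1997, §7.1 Thm. 7.3 (Weierstrass preparation)] -/
theorem span_eq_span_weierstrassDistinguished {F : IwasawaAlgebra p}
    (hF : F.map (IsLocalRing.residue ℤ_[p]) ≠ 0) :
    Ideal.span {F} = Ideal.span {((F.weierstrassDistinguished hF : Polynomial ℤ_[p]) : IwasawaAlgebra p)} := by
  conv_lhs => rw [F.eq_weierstrassDistinguished_mul_weierstrassUnit hF]
  exact Ideal.span_singleton_mul_right_unit (F.isUnit_weierstrassUnit hF) _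

/-- The distinguished polynomial of `F` has degree the Weierstrass degree `ord_T (F mod p)`.
[cite: Washington1997, §7.1 Thm. 7.3] -/
theorem natDegree_weierstrassDistinguished_eq {F : IwasawaAlgebra p}
    (hF : F.map (IsLocalRing.residue ℤ_[p]) ≠ 0) :
    (F.weierstrassDistinguished hF).natDegree = (F.map (IsLocalRing.residue ℤ_[p])).order.toNat :=
  (F.isWeierstrassFactorization_weierstrassDistinguished_weierstrassUnit hF).natDegree_eq_toNat_order_map

/-- **`#(Λ ⧸ (F, q_m)) = p^s`, `s = ord_T (F mod p)` the Weierstrass degree of `F`, for EVERY `m > s`** —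
independent of `m`. Weierstrass preparation `F = f · u` reduces to the tree's count
`card_quotient_span_coe_pow_sup_span_qm` for the distinguished `f` (`(f, q_m) = (f, p)`, `Λ/(f)` free of
rank `deg f = s`). [cite: Howard2004HeegnerKolyvagin, proof of Thm. 2.2.10 (specialisation at 𝔮 = T^m + p)]
[cite: Washington1997, §7.1 Thm. 7.3; §13.2 Lemma 13.7] -/
theorem natCard_quotient_span_sup_span_qm_eq_pow_order {F : IwasawaAlgebra p}
    (hF : F.map (IsLocalRing.residue ℤ_[p]) ≠ 0) {m : ℕ}
    (hm : (F.map (IsLocalRing.residue ℤ_[p])).order.toNat < m) :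
    Nat.card (IwasawaAlgebra p ⧸ (Ideal.span {F} ⊔
      Ideal.span {(X ^ m + C (p : ℤ_[p]) : IwasawaAlgebra p)})) =
        p ^ (F.map (IsLocalRing.residue ℤ_[p])).order.toNat := by
  have hfd := F.isDistinguishedAt_weierstrassDistinguished hF
  have hdeg := natDegree_weierstrassDistinguished_eq p hF
  have h := card_quotient_span_coe_pow_sup_span_qm p hfd 1 (m := m) (by rw [one_mul, hdeg]; exact hm)
  rw [pow_one, one_mul, hdeg] at h
  rw [span_eq_span_weierstrassDistinguished p hF]
  exact h

/-- `Λ ⧸ (F, q_m)` is finite for `F mod p ≠ 0` and `m` beyond the Weierstrass degree.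
[cite: Howard2004HeegnerKolyvagin, §2.2 (S_𝔮 finite over ℤ_p modulo a non-zero element)] -/
theorem finite_quotient_span_sup_span_qm_of_map_residue_ne_zero {F : IwasawaAlgebra p}
    (hF : F.map (IsLocalRing.residue ℤ_[p]) ≠ 0) {m : ℕ}
    (hm : (F.map (IsLocalRing.residue ℤ_[p])).order.toNat < m) :
    Finite (IwasawaAlgebra p ⧸ (Ideal.span {F} ⊔
      Ideal.span {(X ^ m + C (p : ℤ_[p]) : IwasawaAlgebra p)})) := by
  apply Nat.finite_of_card_ne_zero
  rw [natCard_quotient_span_sup_span_qm_eq_pow_order p hF hm]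
  exact pow_ne_zero _ hp.out.ne_zero

/-- **`#(Λ ⧸ (F, q_m)) ≤ p^k` whenever `coeff_k F` is a unit and `k < m`** — uniformly in `m`.
[cite: Howard2004HeegnerKolyvagin, proof of Thm. 2.2.10] [cite: Washington1997, §7.1 Thm. 7.3] -/
theorem natCard_quotient_span_sup_span_qm_le_of_isUnit_coeff {F : IwasawaAlgebra p} {k m : ℕ}
    (hk : k < m) (hu : IsUnit (coeff k F)) :
    Nat.card (IwasawaAlgebra p ⧸ (Ideal.span {F} ⊔
      Ideal.span {(X ^ m + C (p : ℤ_[p]) : IwasawaAlgebra p)})) ≤ p ^ k := by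
  have hF := map_residue_ne_zero_of_isUnit_coeff p hu
  have hs := toNat_order_map_residue_le_of_isUnit_coeff p hu
  rw [natCard_quotient_span_sup_span_qm_eq_pow_order p hF (lt_of_le_of_lt hs hk)]
  exact Nat.pow_le_pow_right hp.out.pos hs

/-- `Λ ⧸ (F, q_m)` is finite whenever `coeff_k F` is a unit and `k < m`.
[cite: Howard2004HeegnerKolyvagin, §2.2] -/
theorem finite_quotient_span_sup_span_qm_of_isUnit_coeff {F : IwasawaAlgebra p} {k m : ℕ}
    (hk : k < m) (hu : IsUnit (coeff k F)) :
    Finite (IwasawaAlgebra p ⧸ (Ideal.span {F} ⊔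
      Ideal.span {(X ^ m + C (p : ℤ_[p]) : IwasawaAlgebra p)})) :=
  finite_quotient_span_sup_span_qm_of_map_residue_ne_zero p (map_residue_ne_zero_of_isUnit_coeff p hu)
    (lt_of_le_of_lt (toNat_order_map_residue_le_of_isUnit_coeff p hu) hk)

/-! ## §3 The same in `S_m = Λ/(q_m)`: `#(S_m/(F̄)) = p^s`, `length_{S_m}(S_m/(F̄)) = s` -/

/-- `#((Λ/J) ⧸ (F̄)) = #(Λ ⧸ (F, J))` (third isomorphism theorem).
[cite: AtiyahMacdonald1969, Prop. 2.18 / third isomorphism theorem] -/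
theorem natCard_quotient_span_mk_eq_natCard_quotient_sup (J : Ideal (IwasawaAlgebra p))
    (F : IwasawaAlgebra p) :
    Nat.card ((IwasawaAlgebra p ⧸ J) ⧸ Ideal.span {Ideal.Quotient.mk J F}) =
      Nat.card (IwasawaAlgebra p ⧸ (Ideal.span {F} ⊔ J)) := by
  have h : Ideal.span {Ideal.Quotient.mk J F} = (Ideal.span {F}).map (Ideal.Quotient.mk J) := by
    rw [Ideal.map_span, Set.image_singleton]
  rw [h, sup_comm]
  exact Nat.card_congr (DoubleQuot.quotQuotEquivQuotSup J (Ideal.span {F})).toEquiv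

/-- **`#(S_m ⧸ (F̄)) = p^s`, `s` the Weierstrass degree of `F`, for every `m > s`.**
[cite: Howard2004HeegnerKolyvagin, proof of Thm. 2.2.10 (𝔮 = T^m + p)] [cite: Washington1997, §7.1 Thm. 7.3] -/
theorem natCard_quotient_span_mk_eq_pow_order {F : IwasawaAlgebra p}
    (hF : F.map (IsLocalRing.residue ℤ_[p]) ≠ 0) {m : ℕ}
    (hm : (F.map (IsLocalRing.residue ℤ_[p])).order.toNat < m) :
    Nat.card ((IwasawaAlgebra p ⧸ Ideal.span {(X ^ m + C (p : ℤ_[p]) : IwasawaAlgebra p)}) ⧸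
      Ideal.span {Ideal.Quotient.mk (Ideal.span {(X ^ m + C (p : ℤ_[p]) : IwasawaAlgebra p)}) F}) =
        p ^ (F.map (IsLocalRing.residue ℤ_[p])).order.toNat := by
  rw [natCard_quotient_span_mk_eq_natCard_quotient_sup, natCard_quotient_span_sup_span_qm_eq_pow_order p hF hm]

/-- **`#(S_m ⧸ (F̄)) ≤ p^k` whenever `coeff_k F` is a unit and `k < m`** — the `m`-UNIFORM twin of
`finite_quotient_span_mk_of_isUnit_coeff`. [cite: Howard2004HeegnerKolyvagin, proof of Thm. 2.2.10]
[cite: Washington1997, §7.1 Thm. 7.3] -/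
theorem natCard_quotient_span_mk_le_of_isUnit_coeff {F : IwasawaAlgebra p} {k m : ℕ} (hk : k < m)
    (hu : IsUnit (coeff k F)) :
    Nat.card ((IwasawaAlgebra p ⧸ Ideal.span {(X ^ m + C (p : ℤ_[p]) : IwasawaAlgebra p)}) ⧸
      Ideal.span {Ideal.Quotient.mk (Ideal.span {(X ^ m + C (p : ℤ_[p]) : IwasawaAlgebra p)}) F}) ≤
        p ^ k := by
  rw [natCard_quotient_span_mk_eq_natCard_quotient_sup]
  exact natCard_quotient_span_sup_span_qm_le_of_isUnit_coeff p hk hu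

/-- **`length_{S_m} (S_m ⧸ (F̄)) = s`**, the Weierstrass degree of `F`, for every `m > s` — i.e.
`v_π(F̄) = s` for the uniformiser `π = T̄` of the DVR `S_m`. [cite: Howard2004HeegnerKolyvagin, §2.2 and
proof of Thm. 2.2.10] [cite: Washington1997, §7.1 Thm. 7.3] -/
theorem length_quotient_span_mk_eq_order {F : IwasawaAlgebra p}
    (hF : F.map (IsLocalRing.residue ℤ_[p]) ≠ 0) {m : ℕ}
    (hm : (F.map (IsLocalRing.residue ℤ_[p])).order.toNat < m) :
    Module.length (IwasawaAlgebra p ⧸ Ideal.span {(X ^ m + C (p : ℤ_[p]) : IwasawaAlgebra p)})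
      ((IwasawaAlgebra p ⧸ Ideal.span {(X ^ m + C (p : ℤ_[p]) : IwasawaAlgebra p)}) ⧸
        Ideal.span {Ideal.Quotient.mk (Ideal.span {(X ^ m + C (p : ℤ_[p]) : IwasawaAlgebra p)}) F}) =
      (F.map (IsLocalRing.residue ℤ_[p])).order.toNat := by
  have hm1 : 1 ≤ m := by omega
  have hcard := natCard_quotient_span_mk_eq_pow_order p hF hm
  haveI : Finite ((IwasawaAlgebra p ⧸ Ideal.span {(X ^ m + C (p : ℤ_[p]) : IwasawaAlgebra p)}) ⧸
      Ideal.span {Ideal.Quotient.mk (Ideal.span {(X ^ m + C (p : ℤ_[p]) : IwasawaAlgebra p)}) F}) := by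
    apply Nat.finite_of_card_ne_zero
    rw [hcard]; exact pow_ne_zero _ hp.out.ne_zero
  have hlen := natCard_eq_pow_length_quotient_X_pow_add_C_of_finite p hm1
    (N := (IwasawaAlgebra p ⧸ Ideal.span {(X ^ m + C (p : ℤ_[p]) : IwasawaAlgebra p)}) ⧸
      Ideal.span {Ideal.Quotient.mk (Ideal.span {(X ^ m + C (p : ℤ_[p]) : IwasawaAlgebra p)}) F})
  rw [hcard] at hlen
  have hfin : Module.length (IwasawaAlgebra p ⧸ Ideal.span {(X ^ m + C (p : ℤ_[p]) : IwasawaAlgebra p)})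
      ((IwasawaAlgebra p ⧸ Ideal.span {(X ^ m + C (p : ℤ_[p]) : IwasawaAlgebra p)}) ⧸
        Ideal.span {Ideal.Quotient.mk (Ideal.span {(X ^ m + C (p : ℤ_[p]) : IwasawaAlgebra p)}) F}) ≠ ⊤ :=
    Module.length_ne_top_iff.mpr Module.isFiniteLength_of_finite
  have hinj := Nat.pow_right_injective hp.out.two_le hlen
  rw [← ENat.coe_toNat hfin, ← hinj]

/-- `length_{S_m} (S_m ⧸ (F̄)) ≤ k` whenever `coeff_k F` is a unit and `k < m`.
[cite: Howard2004HeegnerKolyvagin, proof of Thm. 2.2.10] -/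
theorem length_quotient_span_mk_le_of_isUnit_coeff {F : IwasawaAlgebra p} {k m : ℕ} (hk : k < m)
    (hu : IsUnit (coeff k F)) :
    Module.length (IwasawaAlgebra p ⧸ Ideal.span {(X ^ m + C (p : ℤ_[p]) : IwasawaAlgebra p)})
      ((IwasawaAlgebra p ⧸ Ideal.span {(X ^ m + C (p : ℤ_[p]) : IwasawaAlgebra p)}) ⧸
        Ideal.span {Ideal.Quotient.mk (Ideal.span {(X ^ m + C (p : ℤ_[p]) : IwasawaAlgebra p)}) F}) ≤ k := by
  have hF := map_residue_ne_zero_of_isUnit_coeff p hu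
  have hs := toNat_order_map_residue_le_of_isUnit_coeff p hu
  rw [length_quotient_span_mk_eq_order p hF (lt_of_le_of_lt hs hk)]
  exact_mod_cast hs

/-! ## §4 The consumers' letters: `Δ` (twisted fixed points at `v ∤ p`) and `(1+T)^n − 1` (inertia at `v ∣ p`) -/

/-- **`#(S_m ⧸ (Δ̄)) ≤ p^{2N}` for `Δ = C ℓ² + C (a₁ℓ)(1+T)^N + C a₀ (1+T)^{2N}`, `a₀` a unit, `m > 2N ≥ 2`** —
uniform in `ℓ` and in `m` (the `m`-uniform form of `finite_quotient_span_charTwistElement`).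
[cite: Howard2004HeegnerKolyvagin, §2.2 and proof of Thm. 2.2.10] -/
theorem natCard_quotient_span_charTwistElement_le {m : ℕ} (a₁ ℓ : ℤ_[p]) {a₀ : ℤ_[p]} (ha₀ : IsUnit a₀)
    {N : ℕ} (hN : 1 ≤ N) (hmN : 2 * N < m) :
    Nat.card ((IwasawaAlgebra p ⧸ Ideal.span {(X ^ m + C (p : ℤ_[p]) : IwasawaAlgebra p)}) ⧸
      Ideal.span {Ideal.Quotient.mk (Ideal.span {(X ^ m + C (p : ℤ_[p]) : IwasawaAlgebra p)})
        (C (ℓ ^ 2) + C (a₁ * ℓ) * ((1 : IwasawaAlgebra p) + X) ^ N +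
          C a₀ * ((1 : IwasawaAlgebra p) + X) ^ (2 * N))}) ≤ p ^ (2 * N) := by
  have hu : IsUnit (coeff (2 * N) (C (ℓ ^ 2) + C (a₁ * ℓ) * ((1 : IwasawaAlgebra p) + X) ^ N +
      C a₀ * ((1 : IwasawaAlgebra p) + X) ^ (2 * N))) := by
    rw [coeff_two_mul_charTwistElement p a₁ a₀ ℓ hN]; exact ha₀
  exact natCard_quotient_span_mk_le_of_isUnit_coeff p hmN hu

/-- Coefficient `n` of `(1+T)^n − 1` is `1` for `n ≥ 1`. [cite: Washington1997, §7.1 (polynomials in Λ)] -/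
theorem coeff_self_onePlusX_pow_sub_one {n : ℕ} (hn : 1 ≤ n) :
    coeff n (((1 : IwasawaAlgebra p) + X) ^ n - 1) = 1 := by
  rw [map_sub, coeff_one_add_X_pow, Nat.choose_self, coeff_one, if_neg (by omega)]
  simp

/-- **`#(S_m ⧸ ((1+T)^n − 1)) ≤ p^n` for `1 ≤ n < m`** — uniformly in `m` (the index controlling the
graded local condition at `v ∣ p` along the Eisenstein primes, `ψ(g₀) = (1+T)^{p^t}` for an inertia
element `g₀`). [cite: Howard2004HeegnerKolyvagin, Lemma 2.2.7 and proof of Thm. 2.2.10] -/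
theorem natCard_quotient_span_mk_onePlusX_pow_sub_one_le {n m : ℕ} (hn : 1 ≤ n) (hnm : n < m) :
    Nat.card ((IwasawaAlgebra p ⧸ Ideal.span {(X ^ m + C (p : ℤ_[p]) : IwasawaAlgebra p)}) ⧸
      Ideal.span {Ideal.Quotient.mk (Ideal.span {(X ^ m + C (p : ℤ_[p]) : IwasawaAlgebra p)})
        (((1 : IwasawaAlgebra p) + X) ^ n - 1)}) ≤ p ^ n := by
  have hu : IsUnit (coeff n (((1 : IwasawaAlgebra p) + X) ^ n - 1)) := by
    rw [coeff_self_onePlusX_pow_sub_one p hn]; exact isUnit_one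
  exact natCard_quotient_span_mk_le_of_isUnit_coeff p hnm hu

/-- `#(S_m ⧸ (T̄^n)) = p^n` for `n < m` (`(T^n, q_m) = (T^n, p)`). [cite: Howard2004HeegnerKolyvagin, §2.2 (S_𝔮 = ℤ_p[π], π^m = −p)]
[cite: Washington1997, §13.2 Lemma 13.7] -/
theorem natCard_quotient_span_mk_X_pow_eq {n m : ℕ} (hnm : n < m) :
    Nat.card ((IwasawaAlgebra p ⧸ Ideal.span {(X ^ m + C (p : ℤ_[p]) : IwasawaAlgebra p)}) ⧸
      Ideal.span {Ideal.Quotient.mk (Ideal.span {(X ^ m + C (p : ℤ_[p]) : IwasawaAlgebra p)})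
        ((X : IwasawaAlgebra p) ^ n)}) = p ^ n := by
  haveI : Nontrivial (IsLocalRing.ResidueField ℤ_[p]) := inferInstance
  have hmap : ((X : IwasawaAlgebra p) ^ n).map (IsLocalRing.residue ℤ_[p]) = X ^ n := by
    rw [map_pow, PowerSeries.map_X]
  have hord : (((X : IwasawaAlgebra p) ^ n).map (IsLocalRing.residue ℤ_[p])).order.toNat = n := by
    rw [hmap, PowerSeries.order_X_pow]; rfl
  have hF : ((X : IwasawaAlgebra p) ^ n).map (IsLocalRing.residue ℤ_[p]) ≠ 0 := by
    rw [hmap]; exact pow_ne_zero _ PowerSeries.X_ne_zero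
  have h := natCard_quotient_span_mk_eq_pow_order p hF (m := m) (by rw [hord]; exact hnm)
  rw [hord] at h
  exact h

/-- **`#(S_m ⧸ ((1+T)^{p^t} − 1)) = p^{p^t}` exactly, for every `m > p^t`** — independent of `m`
(`(1+T)^{p^t} − 1` and `T^{p^t}` are associated in `S_m`, tree `associated_onePlusX_pow_sub_one_X_pow`).
[cite: Howard2004HeegnerKolyvagin, Lemma 2.2.7 and proof of Thm. 2.2.10] [cite: Washington1997, §7.1] -/
theorem natCard_quotient_span_mk_onePlusX_prime_pow_sub_one_eq {t m : ℕ} (htm : p ^ t < m) :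
    Nat.card ((IwasawaAlgebra p ⧸ Ideal.span {(X ^ m + C (p : ℤ_[p]) : IwasawaAlgebra p)}) ⧸
      Ideal.span {Ideal.Quotient.mk (Ideal.span {(X ^ m + C (p : ℤ_[p]) : IwasawaAlgebra p)})
        (((1 : IwasawaAlgebra p) + X) ^ p ^ t - 1)}) = p ^ p ^ t := by
  haveI := isDomain_quotient_X_pow_add_C p (m := m) (by omega)
  rw [Ideal.span_singleton_eq_span_singleton.mpr (associated_onePlusX_pow_sub_one_X_pow p htm.le)]
  exact natCard_quotient_span_mk_X_pow_eq p htm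

/-! ## §5 Structure behind the count: `F̄ ~ T̄^s` in `S_m`, hence `T^s ∈ (F, q_m)` -/

/-- **In `S_m`, a distinguished polynomial `g` of degree `d < m` is ASSOCIATED to `T̄^d`**:
`g = T^d + p·h₀` and `p = −T^m` in `S_m` give `ḡ = T̄^d · (1 − T^{m−d} h₀)‾` with `1 − T^{m−d} h₀ ∈ Λˣ`.
[cite: Howard2004HeegnerKolyvagin, proof of Thm. 2.2.10 (𝔮 = T^m + p)] [cite: Washington1997, §7.1 Prop. 7.2] -/
theorem associated_mk_coe_mk_X_pow_natDegree {g : Polynomial ℤ_[p]}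
    (hg : g.IsDistinguishedAt (IsLocalRing.maximalIdeal ℤ_[p])) {m : ℕ} (hm : g.natDegree < m) :
    Associated
      (Ideal.Quotient.mk (Ideal.span {(X ^ m + C (p : ℤ_[p]) : IwasawaAlgebra p)}) (g : IwasawaAlgebra p))
      (Ideal.Quotient.mk (Ideal.span {(X ^ m + C (p : ℤ_[p]) : IwasawaAlgebra p)}) (X ^ g.natDegree)) := by
  obtain ⟨h₀, hh₀⟩ := C_dvd_coe_sub_X_pow p hg
  set d := g.natDegree with hd
  have hu : IsUnit (1 - X ^ (m - d) * h₀ : IwasawaAlgebra p) := by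
    rw [PowerSeries.isUnit_iff_constantCoeff, map_sub, map_one, map_mul, map_pow,
      PowerSeries.constantCoeff_X, zero_pow (by omega), zero_mul, sub_zero]
    exact isUnit_one
  have hgd : (g : IwasawaAlgebra p) = X ^ d + C (p : ℤ_[p]) * h₀ := by
    rw [← hh₀]; ring
  have hXm : (X : IwasawaAlgebra p) ^ m = X ^ (m - d) * X ^ d := by
    rw [← pow_add, Nat.sub_add_cancel hm.le]
  have hkey : Ideal.Quotient.mk (Ideal.span {(X ^ m + C (p : ℤ_[p]) : IwasawaAlgebra p)})
        (g : IwasawaAlgebra p) =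
      Ideal.Quotient.mk (Ideal.span {(X ^ m + C (p : ℤ_[p]) : IwasawaAlgebra p)})
        (X ^ d * (1 - X ^ (m - d) * h₀)) := by
    rw [Ideal.Quotient.eq, Ideal.mem_span_singleton']
    refine ⟨h₀, ?_⟩
    rw [hXm, hgd]
    ring
  rw [hkey, map_mul]
  exact associated_mul_unit_left _ _ (hu.map _)

/-- **In `S_m`, every `F ∈ Λ` with `F mod p ≠ 0` and Weierstrass degree `s < m` is ASSOCIATED to `T̄^s`**
(`F = f·u` by Weierstrass preparation, `f̄ ~ T̄^s`). This is the structure behind §2–§3: `S_m/(F̄) = S_m/(T̄^s)`.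
[cite: Howard2004HeegnerKolyvagin, proof of Thm. 2.2.10] [cite: Washington1997, §7.1 Thm. 7.3, Prop. 7.2] -/
theorem associated_mk_mk_X_pow_order {F : IwasawaAlgebra p}
    (hF : F.map (IsLocalRing.residue ℤ_[p]) ≠ 0) {m : ℕ}
    (hm : (F.map (IsLocalRing.residue ℤ_[p])).order.toNat < m) :
    Associated
      (Ideal.Quotient.mk (Ideal.span {(X ^ m + C (p : ℤ_[p]) : IwasawaAlgebra p)}) F)
      (Ideal.Quotient.mk (Ideal.span {(X ^ m + C (p : ℤ_[p]) : IwasawaAlgebra p)})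
        (X ^ (F.map (IsLocalRing.residue ℤ_[p])).order.toNat)) := by
  have hfd := F.isDistinguishedAt_weierstrassDistinguished hF
  have hdeg := natDegree_weierstrassDistinguished_eq p hF
  have h1 := associated_mk_coe_mk_X_pow_natDegree p hfd (m := m) (by rw [hdeg]; exact hm)
  rw [hdeg] at h1
  have hFeq : Ideal.Quotient.mk (Ideal.span {(X ^ m + C (p : ℤ_[p]) : IwasawaAlgebra p)}) F =
      Ideal.Quotient.mk (Ideal.span {(X ^ m + C (p : ℤ_[p]) : IwasawaAlgebra p)})
        (((F.weierstrassDistinguished hF : Polynomial ℤ_[p]) : IwasawaAlgebra p) *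
          F.weierstrassUnit hF) :=
    congrArg _ (F.eq_weierstrassDistinguished_mul_weierstrassUnit hF)
  rw [hFeq, map_mul]
  exact (associated_mul_unit_left _ _ ((F.isUnit_weierstrassUnit hF).map _)).trans h1

/-- `T̄^s ∈ (F̄)` in `S_m` (`s` the Weierstrass degree of `F`, `m > s`): `F̄ ∣ T̄^s`.
[cite: Howard2004HeegnerKolyvagin, proof of Thm. 2.2.10] -/
theorem mk_X_pow_order_mem_span_mk {F : IwasawaAlgebra p}
    (hF : F.map (IsLocalRing.residue ℤ_[p]) ≠ 0) {m : ℕ}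
    (hm : (F.map (IsLocalRing.residue ℤ_[p])).order.toNat < m) :
    Ideal.Quotient.mk (Ideal.span {(X ^ m + C (p : ℤ_[p]) : IwasawaAlgebra p)})
        (X ^ (F.map (IsLocalRing.residue ℤ_[p])).order.toNat) ∈
      Ideal.span {Ideal.Quotient.mk (Ideal.span {(X ^ m + C (p : ℤ_[p]) : IwasawaAlgebra p)}) F} := by
  obtain ⟨u, hu⟩ := associated_mk_mk_X_pow_order p hF hm
  rw [← hu]
  exact Ideal.mul_mem_right _ _ (Ideal.mem_span_singleton_self _)

/-- **`T^s ∈ (F, q_m)` in `Λ`** for `F mod p ≠ 0` of Weierstrass degree `s < m`: `T^s` kills `Λ/(F, q_m)`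
and every module quotient of it. [cite: Howard2004HeegnerKolyvagin, proof of Thm. 2.2.10] -/
theorem X_pow_order_mem_span_sup_span_qm {F : IwasawaAlgebra p}
    (hF : F.map (IsLocalRing.residue ℤ_[p]) ≠ 0) {m : ℕ}
    (hm : (F.map (IsLocalRing.residue ℤ_[p])).order.toNat < m) :
    (X : IwasawaAlgebra p) ^ (F.map (IsLocalRing.residue ℤ_[p])).order.toNat ∈
      Ideal.span {F} ⊔ Ideal.span {(X ^ m + C (p : ℤ_[p]) : IwasawaAlgebra p)} := by
  have h := mk_X_pow_order_mem_span_mk p hF hm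
  rw [← Ideal.mem_quotient_iff_mem_sup, Ideal.map_span, Set.image_singleton]
  exact h

/-- **`T^k ∈ (F, q_m)` whenever `coeff_k F` is a unit and `k < m`.** [cite: Howard2004HeegnerKolyvagin, proof of Thm. 2.2.10] -/
theorem X_pow_mem_span_sup_span_qm_of_isUnit_coeff {F : IwasawaAlgebra p} {k m : ℕ} (hk : k < m)
    (hu : IsUnit (coeff k F)) :
    (X : IwasawaAlgebra p) ^ k ∈ Ideal.span {F} ⊔ Ideal.span {(X ^ m + C (p : ℤ_[p]) : IwasawaAlgebra p)} := by
  have hF := map_residue_ne_zero_of_isUnit_coeff p hu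
  have hs := toNat_order_map_residue_le_of_isUnit_coeff p hu
  have h := X_pow_order_mem_span_sup_span_qm p hF (lt_of_le_of_lt hs hk)
  obtain ⟨j, hj⟩ := Nat.exists_eq_add_of_le hs
  rw [hj, pow_add]
  exact Ideal.mul_mem_right _ _ h

/-- `T̄^k ∈ (F̄)` in `S_m` whenever `coeff_k F` is a unit and `k < m`. [cite: Howard2004HeegnerKolyvagin, proof of Thm. 2.2.10] -/
theorem mk_X_pow_mem_span_mk_of_isUnit_coeff {F : IwasawaAlgebra p} {k m : ℕ} (hk : k < m)
    (hu : IsUnit (coeff k F)) :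
    Ideal.Quotient.mk (Ideal.span {(X ^ m + C (p : ℤ_[p]) : IwasawaAlgebra p)}) (X ^ k) ∈
      Ideal.span {Ideal.Quotient.mk (Ideal.span {(X ^ m + C (p : ℤ_[p]) : IwasawaAlgebra p)}) F} := by
  have h := X_pow_mem_span_sup_span_qm_of_isUnit_coeff p hk hu
  rw [← Ideal.mem_quotient_iff_mem_sup, Ideal.map_span, Set.image_singleton] at h
  exact h

/-- **`T^{2N} ∈ (Δ, q_m)`** for Howard's `Δ = C ℓ² + C (a₁ℓ)(1+T)^N + C a₀ (1+T)^{2N}`, `a₀` a unit, `m > 2N ≥ 2`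
— uniformly in `ℓ` and `m`. [cite: Howard2004HeegnerKolyvagin, §2.2 and proof of Thm. 2.2.10] -/
theorem X_pow_two_mul_mem_span_charTwistElement_sup_span_qm {m : ℕ} (a₁ ℓ : ℤ_[p]) {a₀ : ℤ_[p]}
    (ha₀ : IsUnit a₀) {N : ℕ} (hN : 1 ≤ N) (hmN : 2 * N < m) :
    (X : IwasawaAlgebra p) ^ (2 * N) ∈
      Ideal.span {(C (ℓ ^ 2) + C (a₁ * ℓ) * ((1 : IwasawaAlgebra p) + X) ^ N +
          C a₀ * ((1 : IwasawaAlgebra p) + X) ^ (2 * N) : IwasawaAlgebra p)} ⊔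
        Ideal.span {(X ^ m + C (p : ℤ_[p]) : IwasawaAlgebra p)} := by
  have hu : IsUnit (coeff (2 * N) (C (ℓ ^ 2) + C (a₁ * ℓ) * ((1 : IwasawaAlgebra p) + X) ^ N +
      C a₀ * ((1 : IwasawaAlgebra p) + X) ^ (2 * N))) := by
    rw [coeff_two_mul_charTwistElement p a₁ a₀ ℓ hN]; exact ha₀
  exact X_pow_mem_span_sup_span_qm_of_isUnit_coeff p hmN hu

/-- **`T^n ∈ ((1+T)^n − 1, q_m)`** for `1 ≤ n < m`. [cite: Howard2004HeegnerKolyvagin, Lemma 2.2.7 and proof of Thm. 2.2.10] -/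
theorem X_pow_mem_span_onePlusX_pow_sub_one_sup_span_qm {n m : ℕ} (hn : 1 ≤ n) (hnm : n < m) :
    (X : IwasawaAlgebra p) ^ n ∈
      Ideal.span {(((1 : IwasawaAlgebra p) + X) ^ n - 1 : IwasawaAlgebra p)} ⊔
        Ideal.span {(X ^ m + C (p : ℤ_[p]) : IwasawaAlgebra p)} := by
  have hu : IsUnit (coeff n (((1 : IwasawaAlgebra p) + X) ^ n - 1)) := by
    rw [coeff_self_onePlusX_pow_sub_one p hn]; exact isUnit_one
  exact X_pow_mem_span_sup_span_qm_of_isUnit_coeff p hnm hu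

end IwasawaAlgebra

end Literature.NumberTheory.EllipticCurves

end
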